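import Summits.ResolutionOfSingularities.ResolutionOfSingularities.Theorems.FrobeniusLadderFRationalResolutionEquivariantLadderSupport
import Summits.ResolutionOfSingularities.ResolutionOfSingularities.Theorems.FrobeniusLadderFRationalResolutionSafeRayCentreStable
import HarnessLib

/-!
# Crux `FrobeniusLadder.FRationalResolution` (stmt-ResolutionOfSingularities-15317), line `redirect`,
# stub `stub_diagonalizableQuotientResolution` — the equivariant projective ladder WITH SUBSTITUTION-SAFE RAYS (lane W‴: L2 instantiated)

`…EquivariantLadderSupport.exists_equivariant_projective_ladder` is stated for an abstract property `P` of ray generators, closed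
under parallelotope lattice points. Lane W‴ needs `P` = SUBSTITUTION-SAFETY of the ray read in the weight coordinates of the
quotient chart (`…SubstitutionSafeRays`, ✓ p829976): weights `c : Fin n → A`, dual lattice
`N = {v | ⟨m, v⟩ ∈ ℤ for every integer exponent m of weight 0} ⊇ ℤⁿ`, and a lattice isomorphism `φ : ℚⁿ ≅ ℚⁿ` carrying `N` onto
the standard lattice `ℤⁿ` of the fan library (so that `S₀ = φ(e_•)` generates the image of the orthant). This file discharges
the two closure hypotheses for `P y := (φ⁻¹ y is substitution-safe)`:

* `sum_symm_single_eq`, `symm_smul_sum_image_eq` — `φ⁻¹` of the corner of `S₀ = φ(e_•)` is the diagonal ray `(q,…,q)`;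
* `safe_symm_corner` — hypothesis `hP₁`: the primitive corner is safe when no weight vanishes (`corner_le_sum_of_weight_ne_zero`);
* `safe_symm_of_parCoeffs` — hypothesis `hP₂`: a parallelotope lattice point of a cone generated by vectors of `S₀` and vectors with
  safe `φ`-preimage has safe `φ`-preimage (`…SafeRayCentreStable.apply_le_sum_of_weight_eq_of_safe_add`, ✓ p830566);
* **`exists_equivariant_projective_ladder_safe`** — the ladder theorem with every non-`S₀` generator having SAFE preimage.

Honest label: bookkeeping for the DESIGN W‴ (the fan side of L2 is now fully instantiated; the construction of `φ` — a ℤ-basis of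
`N` — and the consumers L1/L3 are NOT in the tree). No stub closed by name. No definitions, no named facts, no sorry.
[folklore; cite: KempfEtAl1973, Ch. I §2 Thm. 11] [cite: Fulton1993Toric, §2.6 p. 48]
-/

-- single-problem summit: the doubled namespace component is forced
set_option linter.dupNamespace false

namespace Summit.ResolutionOfSingularities.ResolutionOfSingularities.Theorems.FRationalResolution.SafeLadder

open Literature.Geometry.PolyhedralFans PointedCone Finset
open Summit.ResolutionOfSingularities.ResolutionOfSingularities.Theorems.FRationalResolution.OrbitSeparation
open Summit.ResolutionOfSingularities.ResolutionOfSingularities.Theorems.FRationalResolution.SubstitutionSafeRays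
open Summit.ResolutionOfSingularities.ResolutionOfSingularities.Theorems.FRationalResolution.SafeRayCentreStable
open Summit.ResolutionOfSingularities.ResolutionOfSingularities.Theorems.FRationalResolution.EquivariantLadderSupport

variable {n : ℕ} {A : Type} [AddCommGroup A]

/-- `l ↦ φ (e_l)` is injective. [folklore] -/
theorem injective_map_single (φ : (Fin n → ℚ) ≃ₗ[ℚ] (Fin n → ℚ)) :
    Function.Injective fun l : Fin n => φ (Pi.single l (1 : ℚ)) := by
  intro l l' h
  have h' : (Pi.single l (1 : ℚ) : Fin n → ℚ) = Pi.single l' 1 := φ.injective h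
  by_contra hne
  have := congrFun h' l
  simp [hne] at this

/-- The sum of the coordinate vectors is the diagonal vector `(1,…,1)`. [folklore] -/
theorem sum_single_eq_one : ∑ l : Fin n, (Pi.single l (1 : ℚ) : Fin n → ℚ) = fun _ => 1 := by
  ext i
  rw [Finset.sum_apply]
  simp [Pi.single_apply]

/-- `φ⁻¹` of the sum of `S₀ = φ(e_•)` is `(1,…,1)`. [folklore] -/
theorem sum_symm_image_eq (φ : (Fin n → ℚ) ≃ₗ[ℚ] (Fin n → ℚ)) :
    ∑ s ∈ (Finset.univ.image fun l : Fin n => φ (Pi.single l (1 : ℚ))), φ.symm s = fun _ => 1 := by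
  rw [Finset.sum_image fun x _ y _ h => injective_map_single φ h]
  simp only [LinearEquiv.symm_apply_apply]
  exact sum_single_eq_one

/-- **Hypothesis `hP₁` of the ladder: the primitive corner has SAFE preimage** when no weight vanishes (the fixed locus of the
group is the origin). [folklore; cite: KempfEtAl1973, Ch. I §2] -/
theorem safe_symm_corner (c : Fin n → A) (hc0 : ∀ l, c l ≠ 0) (φ : (Fin n → ℚ) ≃ₗ[ℚ] (Fin n → ℚ)) (q : ℚ)
    (hq : 0 < q) :
    ∀ (u : Fin n → ℕ) (l₀ : Fin n), ∑ l, u l • c l = c l₀ →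
      φ.symm (q • ∑ s ∈ (Finset.univ.image fun l : Fin n => φ (Pi.single l (1 : ℚ))), s) l₀ ≤
        ∑ l, (u l : ℚ) * φ.symm (q • ∑ s ∈ (Finset.univ.image fun l : Fin n => φ (Pi.single l (1 : ℚ))), s) l := by
  rw [map_smul, map_sum, sum_symm_image_eq]
  exact safe_smul c _ q hq.le fun u l₀ hu => corner_le_sum_of_weight_ne_zero c u l₀ (hc0 l₀) hu

/-- **Hypothesis `hP₂` of the ladder: parallelotope lattice points keep SAFE preimages.** Let `φ` carry the dual lattice `N` of
the weights `c` into `ℤⁿ` (`φ v ∈ ℤⁿ ⇒ v ∈ N`), `T` a finite family each of whose members is a vector of `S₀ = φ(e_•)` or has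
safe preimage, and `a ∈ parCoeffs T`. Then `φ⁻¹ (Σ a_t t)` is safe: it is `t' + q` with `t' = (a (φ e_l))_l` in the half-open
cube and `q` a non-negative combination of safe vectors. [folklore; cite: Fulton1993Toric, §2.6 p. 48] -/
theorem safe_symm_of_parCoeffs (c : Fin n → A) (φ : (Fin n → ℚ) ≃ₗ[ℚ] (Fin n → ℚ))
    (hφ : ∀ v : Fin n → ℚ, φ v ∈ latticeN (Fin n) →
      ∀ m : Fin n → ℤ, ∑ l, m l • c l = 0 → ∃ z : ℤ, ∑ l, (m l : ℚ) * v l = z)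
    (T : Finset (Fin n → ℚ)) (a : (Fin n → ℚ) → ℚ)
    (hT : ∀ t ∈ T, t ∈ (Finset.univ.image fun l : Fin n => φ (Pi.single l (1 : ℚ))) ∨
      ∀ (u : Fin n → ℕ) (l₀ : Fin n), ∑ l, u l • c l = c l₀ → φ.symm t l₀ ≤ ∑ l, (u l : ℚ) * φ.symm t l)
    (ha : a ∈ parCoeffs T) :
    ∀ (u : Fin n → ℕ) (l₀ : Fin n), ∑ l, u l • c l = c l₀ →
      φ.symm (∑ t ∈ T, a t • t) l₀ ≤ ∑ l, (u l : ℚ) * φ.symm (∑ t ∈ T, a t • t) l := by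
  classical
  set S₀ : Finset (Fin n → ℚ) := Finset.univ.image fun l : Fin n => φ (Pi.single l (1 : ℚ)) with hS₀
  -- the cube part and the safe part of the preimage
  set t' : Fin n → ℚ := fun l => a (φ (Pi.single l 1)) with ht'
  set q : Fin n → ℚ := ∑ t ∈ T.filter (fun t => ¬ t ∈ S₀), a t • φ.symm t with hqdef
  have hcube : ∑ t ∈ T.filter (· ∈ S₀), a t • φ.symm t = t' := by
    have h1 : ∑ t ∈ T.filter (· ∈ S₀), a t • φ.symm t = ∑ s ∈ S₀, a s • φ.symm s := by
      rw [← Finset.sum_filter_add_sum_filter_not S₀ (· ∈ T) (fun s => a s • φ.symm s)]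
      have hzero : ∑ s ∈ S₀.filter (fun s => ¬ s ∈ T), a s • φ.symm s = 0 :=
        Finset.sum_eq_zero fun s hs => by rw [ha.2.1 s (Finset.mem_filter.mp hs).2, zero_smul]
      rw [hzero, add_zero]
      exact Finset.sum_congr (by ext s; simp only [Finset.mem_filter]; tauto) fun _ _ => rfl
    rw [h1, hS₀, Finset.sum_image fun x _ y _ h => injective_map_single φ h]
    simp only [LinearEquiv.symm_apply_apply]
    ext i
    rw [Finset.sum_apply]
    simp only [Pi.smul_apply, Pi.single_apply, smul_eq_mul, mul_ite, mul_one, mul_zero, Finset.sum_ite_eq,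
      Finset.mem_univ, if_true]
    rw [ht']
  have hsplit : φ.symm (∑ t ∈ T, a t • t) = q + t' := by
    rw [map_sum, ← Finset.sum_filter_add_sum_filter_not T (· ∈ S₀)]
    simp only [map_smul]
    rw [hcube, hqdef, add_comm]
  have hq : ∀ (u : Fin n → ℕ) (l₀ : Fin n), ∑ l, u l • c l = c l₀ → q l₀ ≤ ∑ l, (u l : ℚ) * q l := by
    rw [hqdef]
    refine safe_sum _ c (fun t => φ.symm t) a (fun t _ => (parCoeffs_bounds ha t).1) fun t ht => ?_
    obtain ⟨htT, htS⟩ := Finset.mem_filter.mp ht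
    rcases hT t htT with h | h
    · exact absurd h htS
    · exact h
  have ht0 : ∀ l, 0 ≤ t' l := fun l => (parCoeffs_bounds ha _).1
  have ht1 : ∀ l, t' l < 1 := fun l => (parCoeffs_bounds ha _).2
  have hpN : ∀ m : Fin n → ℤ, ∑ l, m l • c l = 0 → ∃ z : ℤ, ∑ l, (m l : ℚ) * (q + t') l = z := by
    rw [← hsplit]
    refine hφ _ ?_
    rw [LinearEquiv.apply_symm_apply]
    exact ha.2.2
  intro u l₀ hu
  rw [hsplit]
  exact apply_le_sum_of_weight_eq_of_safe_add c q t' hq ht0 hpN u l₀ (ht1 l₀) hu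

/-- **THE EQUIVARIANT PROJECTIVE LADDER WITH SUBSTITUTION-SAFE RAYS (lane W‴, fan side of L2 fully instantiated).** Weights
`c : Fin n → A` with no `c l = 0` (isolated fixed point), `φ : ℚⁿ ≅ ℚⁿ` a linear automorphism with `φ v ∈ ℤⁿ ⇒ v ∈ N`
(`N` the dual lattice of the weight-`0` exponents), `S₀ = φ(e_•)` (`n ≥ 2`, primitive, linearly independent, all proper
subfamilies regular: the image of the orthant is an isolated simplicial cone), `G` a finite group of lattice automorphisms
permuting `S₀`. Then the conclusions of `exists_equivariant_projective_ladder` hold with: every primitive generator `r ∉ S₀` of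
every cone of the ladder fan has SUBSTITUTION-SAFE preimage `φ⁻¹ r` (so the symmetric safe-ray centre lemma
`…SafeRayCentreStable.map_span_centre_le_span_centre`, ✓ p830301, applies to the rays and the `G`-invariant order function).
[cite: KempfEtAl1973, Ch. I §2 Thm. 10, Thm. 11, Ch. II §2] [cite: Fulton1993Toric, §2.6 p. 48] -/
theorem exists_equivariant_projective_ladder_safe (c : Fin n → A) (hc0 : ∀ l, c l ≠ 0)
    (φ : (Fin n → ℚ) ≃ₗ[ℚ] (Fin n → ℚ))
    (hφ : ∀ v : Fin n → ℚ, φ v ∈ latticeN (Fin n) →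
      ∀ m : Fin n → ℤ, ∑ l, m l • c l = 0 → ∃ z : ℤ, ∑ l, (m l : ℚ) * v l = z)
    (hprim : ∀ s ∈ (Finset.univ.image fun l : Fin n => φ (Pi.single l (1 : ℚ))), IsPrimitive s)
    (hli : LinearIndepOn ℚ id ((Finset.univ.image fun l : Fin n => φ (Pi.single l (1 : ℚ))) : Set (Fin n → ℚ)))
    (h2 : 2 ≤ (Finset.univ.image fun l : Fin n => φ (Pi.single l (1 : ℚ))).card)
    (hiso : ∀ J : Finset (Fin n → ℚ), J ⊂ (Finset.univ.image fun l : Fin n => φ (Pi.single l (1 : ℚ))) → IsRegularGens J)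
    (hfg : (PointedCone.hull ℚ ((Finset.univ.image fun l : Fin n => φ (Pi.single l (1 : ℚ))) : Set (Fin n → ℚ))).FG)
    (hsal : IsSalient (PointedCone.hull ℚ ((Finset.univ.image fun l : Fin n => φ (Pi.single l (1 : ℚ))) : Set (Fin n → ℚ))))
    {G : Set ((Fin n → ℚ) ≃ₗ[ℚ] (Fin n → ℚ))} (hGfin : G.Finite) (hG1 : LinearEquiv.refl ℚ (Fin n → ℚ) ∈ G)
    (hGN : ∀ g ∈ G, ∀ x ∈ latticeN (Fin n), g x ∈ latticeN (Fin n))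
    (hGsymm : ∀ g ∈ G, g.symm ∈ G) (hGtrans : ∀ g ∈ G, ∀ h ∈ G, g.trans h ∈ G)
    (hGS₀ : ∀ g ∈ G, ∀ s ∈ (Finset.univ.image fun l : Fin n => φ (Pi.single l (1 : ℚ))),
      g s ∈ (Finset.univ.image fun l : Fin n => φ (Pi.single l (1 : ℚ)))) :
    ∃ l : List (Fin n → ℚ), (∀ w ∈ l, w ∈ latticeN (Fin n) ∧ w ≠ 0) ∧
      ((Fan.ofCone _ hfg hsal).starIter l).Refines (Fan.ofCone _ hfg hsal) ∧
      ((Fan.ofCone _ hfg hsal).starIter l).IsRegular ∧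
      ((Fan.ofCone _ hfg hsal).starIter l).IsPrimSimplicial ∧
      (∀ g ∈ G, ∀ ρ ∈ ((Fan.ofCone _ hfg hsal).starIter l).cones,
        ρ.map (g : (Fin n → ℚ) →ₗ[ℚ] (Fin n → ℚ)) ∈ ((Fan.ofCone _ hfg hsal).starIter l).cones) ∧
      (∀ τ : PointedCone ℚ (Fin n → ℚ),
        τ.IsFaceOf (PointedCone.hull ℚ ((Finset.univ.image fun l : Fin n => φ (Pi.single l (1 : ℚ))) : Set (Fin n → ℚ))) →
        τ ≠ PointedCone.hull ℚ ((Finset.univ.image fun l : Fin n => φ (Pi.single l (1 : ℚ))) : Set (Fin n → ℚ)) →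
          τ ∈ ((Fan.ofCone _ hfg hsal).starIter l).cones ∧ ∀ w ∈ l, w ∉ τ) ∧
      (∀ ρ ∈ ((Fan.ofCone _ hfg hsal).starIter l).cones, ∀ K : Finset (Fin n → ℚ), IsPrimGens ρ K → ∀ r ∈ K,
        r ∈ (Finset.univ.image fun l : Fin n => φ (Pi.single l (1 : ℚ))) ∨
          ∀ (u : Fin n → ℕ) (l₀ : Fin n), ∑ l, u l • c l = c l₀ → φ.symm r l₀ ≤ ∑ l, (u l : ℚ) * φ.symm r l) ∧
      ∃ m : PointedCone ℚ (Fin n → ℚ) → (Fin n → ℚ),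
        ((Fan.ofCone _ hfg hsal).starIter l).IsStrictSupport m ∧
        (∀ ρ ∈ ((Fan.ofCone _ hfg hsal).starIter l).cones, m ρ ∈ latticeN (Fin n)) ∧
        (∀ ρ ∈ ((Fan.ofCone _ hfg hsal).starIter l).cones,
          ∀ x ∈ PointedCone.hull ℚ ((Finset.univ.image fun l : Fin n => φ (Pi.single l (1 : ℚ))) : Set (Fin n → ℚ)),
          0 ≤ m ρ ⬝ᵥ x) ∧
        (∀ τ : PointedCone ℚ (Fin n → ℚ),
          τ.IsFaceOf (PointedCone.hull ℚ ((Finset.univ.image fun l : Fin n => φ (Pi.single l (1 : ℚ))) : Set (Fin n → ℚ))) →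
          τ ≠ PointedCone.hull ℚ ((Finset.univ.image fun l : Fin n => φ (Pi.single l (1 : ℚ))) : Set (Fin n → ℚ)) →
          ∀ ρ ∈ ((Fan.ofCone _ hfg hsal).starIter l).cones, ∀ x ∈ ρ, x ∈ τ → m ρ ⬝ᵥ x = 0) ∧
        (∀ h ∈ G, ∀ (ρ : PointedCone ℚ (Fin n → ℚ)) (x : Fin n → ℚ),
          m (ρ.map (h : (Fin n → ℚ) →ₗ[ℚ] (Fin n → ℚ))) ⬝ᵥ h x = m ρ ⬝ᵥ x) ∧
        (∃ ρ ∈ ((Fan.ofCone _ hfg hsal).starIter l).cones, ∃ x ∈ ρ, 0 < m ρ ⬝ᵥ x) :=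
  exists_equivariant_projective_ladder hprim hli h2 hiso hfg hsal hGfin hG1 hGN hGsymm hGtrans hGS₀
    (fun y => ∀ (u : Fin n → ℕ) (l₀ : Fin n), ∑ l, u l • c l = c l₀ → φ.symm y l₀ ≤ ∑ l, (u l : ℚ) * φ.symm y l)
    (fun q hq _ => safe_symm_corner c hc0 φ q hq) (fun T a hT ha => safe_symm_of_parCoeffs c φ hφ T a hT ha)

end Summit.ResolutionOfSingularities.ResolutionOfSingularities.Theorems.FRationalResolution.SafeLadder
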